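import Literature.Geometry.Riemannian.ColdingMinicozziEntropy
import HarnessLib

/-!
# Gaussian areas under bi-Lipschitz distortion

Tools for the lower entropy bound of `ColdingMinicozziEntropyLowerBound.lean` (Colding–Minicozzi
2012, Lemma 7.2 (3): a `C¹` submanifold looks like its tangent plane at small scales):

* `exists_nhds_norm_sub_sub_le_of_hasStrictFDerivAt` — strict differentiability unpacked:
  `‖g y - g z - L (y - z)‖ ≤ ε ‖y - z‖` near the point;
* `hausdorffMeasure_le_mul_image_of_coLipschitz` and its variants — **a `c`-co-Lipschitz map
  (`c · dist y z ≤ dist (h y) (h z)` on `S`) satisfies `c^d μH[d](S) ≤ μH[d](h(S))`**, because its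
  inverse on `h(S)` is `c⁻¹`-Lipschitz (Federer 1969, 2.10.11, Mathlib's
  `LipschitzOnWith.hausdorffMeasure_image_le`); also for `μHE[d]`;
* `gaussianArea_image_ge` — **distortion comparison**: if `h : T → F` is `(1+ε)`-Lipschitz and
  `(1-ε)`-co-Lipschitz on `ball 0 r ⊆ T`, then for all `t > 0`
  `((1-ε)/(1+ε))ⁿ · F^T_{0, t/(1+ε)²}(B_r) ≤ F^F_{h 0, t}(h(B_r))` for the Gaussian areas
  `F_{p,t} = gaussianArea n p t` of `ColdingMinicozziEntropy.lean` in `T` and in `F`; proved by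
  the layer-cake formula on both sides (`lintegral_gaussianWeight_image_ge`), whose super-level
  sets are balls (as in `ColdingMinicozziEntropyFinite.lean`, `setOf_lt_gaussian_eq_ball`; re-derived
  inside the proof to keep this file independent of that one).

Everything is proved; no definitions and no named facts are introduced.

## References

* T. H. Colding, W. P. Minicozzi II, *Generic mean curvature flow I; generic singularities*,
  Ann. of Math. 175 (2012) 755–833, Lemma 7.2. [ColdingMinicozzi2012]
* H. Federer, *Geometric Measure Theory* (1969), 2.10.11. [Federer1969]
-/

noncomputable section

open Set Function Filter Module Metric
open _root_.MeasureTheory _root_.MeasureTheory.Measure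
open scoped ENNReal NNReal Topology

namespace Literature.Geometry.Riemannian

/-! ### Quantitative strict differentiability -/

section StrictDiff

variable {E F : Type*} [NormedAddCommGroup E] [NormedSpace ℝ E]
  [NormedAddCommGroup F] [NormedSpace ℝ F]

/-- **Strict differentiability, quantitatively**: if `HasStrictFDerivAt g L x` then for every
`ε > 0` there is a neighbourhood `U` of `x` with `‖g y - g z - L (y - z)‖ ≤ ε ‖y - z‖` for all
`y, z ∈ U` (the definition, unpacked). [folklore] -/
theorem exists_nhds_norm_sub_sub_le_of_hasStrictFDerivAt {g : E → F} {L : E →L[ℝ] F} {x : E}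
    (hg : HasStrictFDerivAt g L x) {ε : ℝ} (hε : 0 < ε) :
    ∃ U ∈ 𝓝 x, ∀ y ∈ U, ∀ z ∈ U, ‖g y - g z - L (y - z)‖ ≤ ε * ‖y - z‖ := by
  have hev := hg.isLittleO.def hε
  rw [nhds_prod_eq] at hev
  obtain ⟨U, hU, hUU⟩ := Filter.mem_prod_self_iff.1 hev
  exact ⟨U, hU, fun y hy z hz => hUU (mk_mem_prod hy hz)⟩

end StrictDiff

/-! ### Co-Lipschitz maps decrease Hausdorff measure by at most `c^{-d}` -/

section CoLipschitzMeasure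

variable {X Y : Type*} [MetricSpace X] [MeasurableSpace X] [BorelSpace X]
  [MetricSpace Y] [MeasurableSpace Y] [BorelSpace Y]

/-- **A `c`-co-Lipschitz map decreases `μH[d]` by at most `c^{-d}`**: if
`c · dist y z ≤ dist (h y) (h z)` on `S` (`c > 0`), then `μH[d] S ≤ c^{-d} μH[d] (h '' S)` —
`h` is injective on `S` and its inverse on `h '' S` is `c⁻¹`-Lipschitz, so Federer 2.10.11
(Mathlib's `LipschitzOnWith.hausdorffMeasure_image_le`) applies to it.
[cite: Federer1969, 2.10.11] -/
theorem hausdorffMeasure_le_mul_image_of_coLipschitz [Nonempty X] {h : X → Y} {S : Set X}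
    {c : ℝ≥0} (hc : 0 < c) (hco : ∀ y ∈ S, ∀ z ∈ S, (c : ℝ) * dist y z ≤ dist (h y) (h z))
    {d : ℝ} (hd : 0 ≤ d) :
    (μH[d] : Measure X) S ≤ (c⁻¹ : ℝ≥0∞) ^ d * (μH[d] : Measure Y) (h '' S) := by
  -- `h` is injective on `S`, with inverse `k`
  have hinj : InjOn h S := by
    intro y hy z hz hyz
    have := hco y hy z hz
    rw [hyz, dist_self] at this
    have h0 : dist y z ≤ 0 := by
      by_contra hlt
      push Not at hlt
      have : (0 : ℝ) < c * dist y z := mul_pos hc hlt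
      linarith
    exact dist_le_zero.1 h0
  set k : Y → X := invFunOn h S with hk
  have hleft : LeftInvOn k h S := hinj.leftInvOn_invFunOn
  have hkS : k '' (h '' S) = S := hleft.image_image
  have hlip : LipschitzOnWith c⁻¹ k (h '' S) := by
    rintro _ ⟨y, hy, rfl⟩ _ ⟨z, hz, rfl⟩
    rw [edist_dist, edist_dist, hleft hy, hleft hz]
    have h1 := hco y hy z hz
    have h2 : dist y z ≤ (c : ℝ)⁻¹ * dist (h y) (h z) := by
      rw [le_inv_mul_iff₀ (by exact_mod_cast hc)]
      exact h1
    calc ENNReal.ofReal (dist y z) ≤ ENNReal.ofReal ((c : ℝ)⁻¹ * dist (h y) (h z)) :=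
          ENNReal.ofReal_le_ofReal h2
      _ = (c⁻¹ : ℝ≥0) * ENNReal.ofReal (dist (h y) (h z)) := by
          rw [ENNReal.ofReal_mul (by positivity), ← NNReal.coe_inv, ENNReal.ofReal_coe_nnreal]
  calc (μH[d] : Measure X) S = (μH[d] : Measure X) (k '' (h '' S)) := by rw [hkS]
    _ ≤ (c⁻¹ : ℝ≥0∞) ^ d * (μH[d] : Measure Y) (h '' S) := by
        have := hlip.hausdorffMeasure_image_le hd
        rwa [ENNReal.coe_inv hc.ne'] at this

/-- `c^d · μH[d] S ≤ μH[d] (h '' S)` for a `c`-co-Lipschitz `h` on `S`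
(multiplicative form of `hausdorffMeasure_le_mul_image_of_coLipschitz`). [cite: Federer1969, 2.10.11] -/
theorem mul_hausdorffMeasure_le_image_of_coLipschitz [Nonempty X] {h : X → Y} {S : Set X}
    {c : ℝ≥0} (hc : 0 < c) (hco : ∀ y ∈ S, ∀ z ∈ S, (c : ℝ) * dist y z ≤ dist (h y) (h z))
    {d : ℝ} (hd : 0 ≤ d) :
    (c : ℝ≥0∞) ^ d * (μH[d] : Measure X) S ≤ (μH[d] : Measure Y) (h '' S) := by
  have h1 := hausdorffMeasure_le_mul_image_of_coLipschitz hc hco hd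
  have hc0 : (c : ℝ≥0∞) ≠ 0 := by exact_mod_cast hc.ne'
  have hcc : (c : ℝ≥0∞) ^ d * (c⁻¹ : ℝ≥0∞) ^ d = 1 := by
    rw [← ENNReal.mul_rpow_of_nonneg _ _ hd, ENNReal.mul_inv_cancel hc0 ENNReal.coe_ne_top,
      ENNReal.one_rpow]
  calc (c : ℝ≥0∞) ^ d * (μH[d] : Measure X) S
      ≤ (c : ℝ≥0∞) ^ d * ((c⁻¹ : ℝ≥0∞) ^ d * (μH[d] : Measure Y) (h '' S)) := mul_le_mul' le_rfl h1
    _ = (μH[d] : Measure Y) (h '' S) := by rw [← mul_assoc, hcc, one_mul]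

/-- `c^d · μHE[d] S ≤ μHE[d] (h '' S)` for a `c`-co-Lipschitz `h` on `S` (Euclidean
normalisation; the Haar factor is the same on both sides). [cite: Federer1969, 2.10.11] -/
theorem mul_euclideanHausdorffMeasure_le_image_of_coLipschitz [Nonempty X] {h : X → Y} {S : Set X}
    {c : ℝ≥0} (hc : 0 < c) (hco : ∀ y ∈ S, ∀ z ∈ S, (c : ℝ) * dist y z ≤ dist (h y) (h z))
    (d : ℕ) :
    (c : ℝ≥0∞) ^ (d : ℝ) * (μHE[d] : Measure X) S ≤ (μHE[d] : Measure Y) (h '' S) := by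
  have h1 := mul_hausdorffMeasure_le_image_of_coLipschitz hc hco (Nat.cast_nonneg d) (h := h) (S := S)
  rw [euclideanHausdorffMeasure_def, euclideanHausdorffMeasure_def, Measure.smul_apply,
    Measure.smul_apply, ENNReal.smul_def, ENNReal.smul_def, smul_eq_mul, smul_eq_mul,
    mul_left_comm]
  exact mul_le_mul' le_rfl h1

/-- `ENNReal.ofReal (c^d) · μHE[d] S ≤ μHE[d] (h '' S)` for a real constant `c > 0` with
`c · dist y z ≤ dist (h y) (h z)` on `S`. [cite: Federer1969, 2.10.11] -/
theorem ofReal_pow_mul_euclideanHausdorffMeasure_le_image [Nonempty X] {h : X → Y} {S : Set X}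
    {c : ℝ} (hc : 0 < c) (hco : ∀ y ∈ S, ∀ z ∈ S, c * dist y z ≤ dist (h y) (h z)) (d : ℕ) :
    ENNReal.ofReal (c ^ d) * (μHE[d] : Measure X) S ≤ (μHE[d] : Measure Y) (h '' S) := by
  have hc' : 0 < c.toNNReal := Real.toNNReal_pos.2 hc
  have hco' : ∀ y ∈ S, ∀ z ∈ S, ((c.toNNReal : ℝ≥0) : ℝ) * dist y z ≤ dist (h y) (h z) := by
    rw [Real.coe_toNNReal c hc.le]
    exact hco
  have key := mul_euclideanHausdorffMeasure_le_image_of_coLipschitz hc' hco' d (h := h)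
  have hcoe : ((c.toNNReal : ℝ≥0) : ℝ≥0∞) ^ (d : ℝ) = ENNReal.ofReal (c ^ d) := by
    rw [ENNReal.rpow_natCast, ENNReal.ofReal_pow hc.le]
    rfl
  rwa [hcoe] at key

end CoLipschitzMeasure

/-! ### Distortion comparison for a bi-Lipschitz parametrisation -/

section Distortion

variable {T : Type*} [NormedAddCommGroup T] [MeasurableSpace T] [BorelSpace T]
  {F : Type*} [NormedAddCommGroup F] [MeasurableSpace F] [BorelSpace F]

/-- The identity of normalising factors `((1-ε)/(1+ε))ⁿ (4π t/(1+ε)²)^{-n/2} = (4πt)^{-n/2} (1-ε)ⁿ`.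
[folklore] -/
theorem distortion_normalization_identity (n : ℕ) {ε t : ℝ} (hε : 0 < ε) (ht : 0 < t) :
    ((1 - ε) / (1 + ε)) ^ n * (4 * Real.pi * (t / (1 + ε) ^ 2)) ^ (-(n : ℝ) / 2) =
      (4 * Real.pi * t) ^ (-(n : ℝ) / 2) * (1 - ε) ^ n := by
  have ha : 0 < 1 + ε := by linarith
  have h2 : ((1 + ε) ^ 2) ^ ((n : ℝ) / 2) = (1 + ε) ^ n := by
    rw [← Real.rpow_natCast (1 + ε) 2, ← Real.rpow_mul ha.le, Nat.cast_ofNat,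
      show (2 : ℝ) * ((n : ℝ) / 2) = n by ring, Real.rpow_natCast]
  have h1 : (4 * Real.pi * (t / (1 + ε) ^ 2)) ^ (-(n : ℝ) / 2) =
      (4 * Real.pi * t) ^ (-(n : ℝ) / 2) * (1 + ε) ^ n := by
    rw [show 4 * Real.pi * (t / (1 + ε) ^ 2) = (4 * Real.pi * t) * ((1 + ε) ^ 2)⁻¹ by ring,
      Real.mul_rpow (by positivity) (by positivity), Real.inv_rpow (by positivity), neg_div,
      Real.rpow_neg (by positivity : (0 : ℝ) ≤ (1 + ε) ^ 2), inv_inv, h2]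
  rw [h1, div_pow]
  field_simp

/-- **Core comparison.** Let `h : T → F` be `(1+ε)`-Lipschitz and `(1-ε)`-co-Lipschitz on the
ball `B_r = ball 0 r` of the normed space `T` (`0 < ε < 1`, `r > 0`). Then for `t > 0`
`(1-ε)ⁿ ∫_{B_r} e^{-‖v‖²/4t'} dμHE[n] ≤ ∫_{h(B_r)} e^{-‖y - h 0‖²/4t} dμHE[n]`, `t' = t/(1+ε)²`:
layer cake on both sides (`lintegral_eq_lintegral_meas_lt`); for `0 < s < 1` the super-level
sets are the balls of radii `R' = √(4t' log(1/s))` in `T` and `R = (1+ε) R'` around `h 0` in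
`F` (`setOf_lt_gaussian_eq_ball`), `h(B_r ∩ B_{R'}) ⊆ B(h 0, R)` by the Lipschitz bound, and
`(1-ε)ⁿ μHE[n](S) ≤ μHE[n](h(S))` by the co-Lipschitz bound. [cite: ColdingMinicozzi2012, Lemma 7.2] -/
theorem lintegral_gaussianWeight_image_ge {n : ℕ} {h : T → F} {ε r : ℝ} (hε : 0 < ε) (hε1 : ε < 1)
    (hr : 0 < r)
    (hlip : ∀ v ∈ ball (0 : T) r, ∀ w ∈ ball (0 : T) r, ‖h v - h w‖ ≤ (1 + ε) * ‖v - w‖)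
    (hco : ∀ v ∈ ball (0 : T) r, ∀ w ∈ ball (0 : T) r, (1 - ε) * ‖v - w‖ ≤ ‖h v - h w‖)
    {t : ℝ} (ht : 0 < t) :
    ENNReal.ofReal ((1 - ε) ^ n) *
        ∫⁻ v in ball (0 : T) r, gaussianWeight (0 : T) (t / (1 + ε) ^ 2) v ∂(μHE[n] : Measure T) ≤
      ∫⁻ y in h '' ball (0 : T) r, gaussianWeight (h 0) t y ∂(μHE[n] : Measure F) := by
  have ha : 0 < 1 + ε := by linarith
  have hc : 0 < 1 - ε := by linarith
  set S := ball (0 : T) r with hS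
  set t' := t / (1 + ε) ^ 2 with ht'
  have ht'pos : 0 < t' := by positivity
  -- super-level sets of the Gaussian weights: balls for `0 < s < 1`, empty for `s ≥ 1`
  have hlevelT : ∀ (p : T) {τ : ℝ}, 0 < τ → ∀ {s : ℝ}, 0 < s →
      {x : T | s < Real.exp (-(‖x - p‖ ^ 2) / (4 * τ))} = ball p (Real.sqrt (4 * τ * -Real.log s)) := by
    intro p τ hτ s hs
    ext x
    rw [mem_setOf_eq, mem_ball, dist_eq_norm, ← Real.log_lt_iff_lt_exp hs,
      Real.lt_sqrt (norm_nonneg _), lt_div_iff₀ (by positivity : (0 : ℝ) < 4 * τ)]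
    constructor <;> intro h <;> nlinarith
  have hlevelF : ∀ (p : F) {τ : ℝ}, 0 < τ → ∀ {s : ℝ}, 0 < s →
      {x : F | s < Real.exp (-(‖x - p‖ ^ 2) / (4 * τ))} = ball p (Real.sqrt (4 * τ * -Real.log s)) := by
    intro p τ hτ s hs
    ext x
    rw [mem_setOf_eq, mem_ball, dist_eq_norm, ← Real.log_lt_iff_lt_exp hs,
      Real.lt_sqrt (norm_nonneg _), lt_div_iff₀ (by positivity : (0 : ℝ) < 4 * τ)]
    constructor <;> intro h <;> nlinarith
  have hempty : ∀ {s : ℝ}, 1 ≤ s →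
      {v : T | s < Real.exp (-(‖v - 0‖ ^ 2) / (4 * t'))} = ∅ := by
    intro s hs1
    ext v
    simp only [mem_setOf_eq, mem_empty_iff_false, iff_false, not_lt]
    refine (Real.exp_le_one_iff.2 ?_).trans hs1
    exact div_nonpos_of_nonpos_of_nonneg (neg_nonpos.2 (sq_nonneg _)) (by positivity)
  set μF : Measure F := (μHE[n] : Measure F).restrict (h '' S) with hμF
  set μT : Measure T := (μHE[n] : Measure T).restrict S with hμT
  -- layer cake on both sides
  have hlayF : ∫⁻ y in h '' S, gaussianWeight (h 0) t y ∂(μHE[n] : Measure F) =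
      ∫⁻ s in Ioi 0, μF {y : F | s < Real.exp (-(‖y - h 0‖ ^ 2) / (4 * t))} :=
    lintegral_eq_lintegral_meas_lt μF (f := fun y : F => Real.exp (-(‖y - h 0‖ ^ 2) / (4 * t)))
      (Eventually.of_forall fun y => (Real.exp_pos _).le) (by fun_prop)
  have hlayT : ∫⁻ v in S, gaussianWeight (0 : T) t' v ∂(μHE[n] : Measure T) =
      ∫⁻ s in Ioi 0, μT {v : T | s < Real.exp (-(‖v - 0‖ ^ 2) / (4 * t'))} :=
    lintegral_eq_lintegral_meas_lt μT (f := fun v : T => Real.exp (-(‖v - 0‖ ^ 2) / (4 * t')))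
      (Eventually.of_forall fun v => (Real.exp_pos _).le) (by fun_prop)
  -- the `T` side lives on `(0, 1)`
  have hsplit : Ioi (0 : ℝ) = Ioo 0 1 ∪ Ici 1 := (Ioo_union_Ici_eq_Ioi zero_lt_one).symm
  have hdisj : Disjoint (Ioo (0 : ℝ) 1) (Ici 1) :=
    disjoint_left.2 fun s hs hs' => not_le.2 hs.2 hs'
  have hT01 : ∫⁻ s in Ioi 0, μT {v : T | s < Real.exp (-(‖v - 0‖ ^ 2) / (4 * t'))} =
      ∫⁻ s in Ioo 0 1, μT {v : T | s < Real.exp (-(‖v - 0‖ ^ 2) / (4 * t'))} := by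
    rw [hsplit, lintegral_union measurableSet_Ici hdisj]
    have hzero : ∫⁻ s in Ici (1 : ℝ), μT {v : T | s < Real.exp (-(‖v - 0‖ ^ 2) / (4 * t'))} = 0 := by
      rw [setLIntegral_congr_fun measurableSet_Ici (fun s hs => by
        rw [hempty (mem_Ici.1 hs), measure_empty])]
      exact lintegral_zero
    rw [hzero, add_zero]
  -- pointwise comparison on `(0, 1)`
  have hpt : ∀ s ∈ Ioo (0 : ℝ) 1,
      ENNReal.ofReal ((1 - ε) ^ n) * μT {v : T | s < Real.exp (-(‖v - 0‖ ^ 2) / (4 * t'))} ≤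
        μF {y : F | s < Real.exp (-(‖y - h 0‖ ^ 2) / (4 * t))} := by
    intro s hs
    have hlog : 0 ≤ -Real.log s := neg_nonneg.2 (Real.log_nonpos hs.1.le hs.2.le)
    set R := Real.sqrt (4 * t * -Real.log s) with hR
    set R' := Real.sqrt (4 * t' * -Real.log s) with hR'
    have hRR' : R = (1 + ε) * R' := by
      rw [hR, hR', ht', show 4 * (t / (1 + ε) ^ 2) * -Real.log s =
        (4 * t * -Real.log s) / (1 + ε) ^ 2 by ring, Real.sqrt_div (by positivity),
        Real.sqrt_sq ha.le]
      field_simp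
    rw [hlevelT (0 : T) ht'pos hs.1, hlevelF (h 0) ht hs.1,
      hμT, hμF, Measure.restrict_apply measurableSet_ball, Measure.restrict_apply measurableSet_ball,
      ← hR, ← hR']
    -- `h '' (ball 0 R' ∩ S) ⊆ ball (h 0) R ∩ h '' S`
    have hsub : h '' (ball 0 R' ∩ S) ⊆ ball (h 0) R ∩ h '' S := by
      rintro _ ⟨v, ⟨hvR, hvS⟩, rfl⟩
      refine ⟨?_, mem_image_of_mem h hvS⟩
      rw [mem_ball, dist_eq_norm, hRR']
      have h0S : (0 : T) ∈ S := mem_ball_self hr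
      calc ‖h v - h 0‖ ≤ (1 + ε) * ‖v - 0‖ := hlip v hvS 0 h0S
        _ < (1 + ε) * R' := by
            rw [sub_zero]
            exact mul_lt_mul_of_pos_left (mem_ball_zero_iff.1 hvR) ha
    refine le_trans ?_ (measure_mono hsub)
    -- co-Lipschitz comparison of measures
    have hco' : ∀ y ∈ ball (0 : T) R' ∩ S, ∀ z ∈ ball (0 : T) R' ∩ S,
        (1 - ε) * dist y z ≤ dist (h y) (h z) := by
      intro y hy z hz
      rw [dist_eq_norm, dist_eq_norm]
      exact hco y hy.2 z hz.2
    exact ofReal_pow_mul_euclideanHausdorffMeasure_le_image (X := T) (Y := F) hc hco' n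
  -- integrate the pointwise comparison
  calc ENNReal.ofReal ((1 - ε) ^ n) *
        ∫⁻ v in S, gaussianWeight (0 : T) t' v ∂(μHE[n] : Measure T)
      = ENNReal.ofReal ((1 - ε) ^ n) *
          ∫⁻ s in Ioo 0 1, μT {v : T | s < Real.exp (-(‖v - 0‖ ^ 2) / (4 * t'))} := by
        rw [hlayT, hT01]
    _ = ∫⁻ s in Ioo 0 1, ENNReal.ofReal ((1 - ε) ^ n) *
          μT {v : T | s < Real.exp (-(‖v - 0‖ ^ 2) / (4 * t'))} := by
        rw [lintegral_const_mul' _ _ ENNReal.ofReal_ne_top]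
    _ ≤ ∫⁻ s in Ioo 0 1, μF {y : F | s < Real.exp (-(‖y - h 0‖ ^ 2) / (4 * t))} :=
        setLIntegral_mono' measurableSet_Ioo hpt
    _ ≤ ∫⁻ s in Ioi 0, μF {y : F | s < Real.exp (-(‖y - h 0‖ ^ 2) / (4 * t))} :=
        lintegral_mono_set Ioo_subset_Ioi_self
    _ = ∫⁻ y in h '' S, gaussianWeight (h 0) t y ∂(μHE[n] : Measure F) := hlayF.symm

/-- **Distortion comparison of Gaussian areas**: under the hypotheses of
`lintegral_gaussianWeight_image_ge`,
`((1-ε)/(1+ε))ⁿ · F_{0, t/(1+ε)²}(B_r) ≤ F_{h 0, t}(h(B_r))` (Gaussian area in `T` on the left,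
in `F` on the right). [cite: ColdingMinicozzi2012, Lemma 7.2] -/
theorem gaussianArea_image_ge {n : ℕ} {h : T → F} {ε r : ℝ} (hε : 0 < ε) (hε1 : ε < 1)
    (hr : 0 < r)
    (hlip : ∀ v ∈ ball (0 : T) r, ∀ w ∈ ball (0 : T) r, ‖h v - h w‖ ≤ (1 + ε) * ‖v - w‖)
    (hco : ∀ v ∈ ball (0 : T) r, ∀ w ∈ ball (0 : T) r, (1 - ε) * ‖v - w‖ ≤ ‖h v - h w‖)
    {t : ℝ} (ht : 0 < t) :
    ENNReal.ofReal (((1 - ε) / (1 + ε)) ^ n) * gaussianArea n (0 : T) (t / (1 + ε) ^ 2) (ball 0 r) ≤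
      gaussianArea n (h 0) t (h '' ball (0 : T) r) := by
  have key := lintegral_gaussianWeight_image_ge (n := n) hε hε1 hr hlip hco ht
  rw [gaussianArea_eq, gaussianArea_eq, gaussianNormalization, gaussianNormalization]
  have hnorm : ENNReal.ofReal (((1 - ε) / (1 + ε)) ^ n) *
      ENNReal.ofReal ((4 * Real.pi * (t / (1 + ε) ^ 2)) ^ (-(n : ℝ) / 2)) =
        ENNReal.ofReal ((4 * Real.pi * t) ^ (-(n : ℝ) / 2)) * ENNReal.ofReal ((1 - ε) ^ n) := by
    have hc : 0 ≤ 1 - ε := by linarith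
    rw [← ENNReal.ofReal_mul (pow_nonneg (div_nonneg hc (by linarith)) n),
      ← ENNReal.ofReal_mul (Real.rpow_nonneg (by positivity) _),
      distortion_normalization_identity n hε ht]
  calc ENNReal.ofReal (((1 - ε) / (1 + ε)) ^ n) *
        (ENNReal.ofReal ((4 * Real.pi * (t / (1 + ε) ^ 2)) ^ (-(n : ℝ) / 2)) *
          ∫⁻ v in ball (0 : T) r, gaussianWeight (0 : T) (t / (1 + ε) ^ 2) v ∂(μHE[n] : Measure T))
      = ENNReal.ofReal ((4 * Real.pi * t) ^ (-(n : ℝ) / 2)) * (ENNReal.ofReal ((1 - ε) ^ n) *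
          ∫⁻ v in ball (0 : T) r, gaussianWeight (0 : T) (t / (1 + ε) ^ 2) v ∂(μHE[n] : Measure T)) := by
        rw [← mul_assoc, hnorm, mul_assoc]
    _ ≤ ENNReal.ofReal ((4 * Real.pi * t) ^ (-(n : ℝ) / 2)) *
          ∫⁻ y in h '' ball (0 : T) r, gaussianWeight (h 0) t y ∂(μHE[n] : Measure F) :=
        mul_le_mul' le_rfl key

end Distortion

end Literature.Geometry.Riemannian

end
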